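import Summits.BirchSwinnertonDyer.Rank1Residual.GaloisImage.PadicRootCensusRoots
import Summits.BirchSwinnertonDyer.Rank1Residual.GaloisImage.LocalThreeTorsionDeciderAt
import HarnessLib

/-!
# Root census with a SPLIT-COVER CERTIFICATE: the residue cover of `RootCensus.check₂` replaced by a
# factorisation `F ≡ lc · ∏ (X − rᵢ)^{eᵢ} (mod p)` — O(1) in `p` (team n1011, row T-D31891 FILE 1;
# seat p04 GEN 15; route planner 1's design note D-31891; sequel of n1011-p17's `PadicRootCensus`,
# `PadicRootCensusTaylor`, `PadicRootCensusRoots`)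

HONEST FRAMING (cell `b2b-bsdres`, run/shared/lean/b2b/bsd-rank1-residual/, verbatim in every
file): the goal of the cell is to DELETE the COMBINATION-SHAPED residual classes of the
Birch–Swinnerton-Dyer formula for ALL analytic-rank `≤ 1` elliptic curves over `ℚ` — "full BSD
formula for every rank `≤ 1` curve in class `C`" assembled STRICTLY from published theorems — so
that the rank-`≤ 1` remainder becomes exactly the CONSTRUCTION-SHAPED classes, which are TYPED
(missing-input `Prop`s), NOT attempted. This is not "finishing BSD". Team n1011 (N10/N11): research
route; this file is a TOOL (pure `p`-adic algebra); nothing is booked by it; no mark / label moved.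
No named fact, no `sorry`; the only definitions are COMPUTABLE bookkeeping (coefficient-list
arithmetic, the Boolean checkers `splitCoverOK`, `check₃`, and the `Option ℕ`-valued `3`-torsion checker
`LocalTorsion3At.threeTorsionCertAt` whose THEOREMS are FILE 2 `LocalThreeTorsionDeciderAtCert`).

## Why a third checker

n1011-p17's root census (`RootCensus.check` / `check₂`) certifies COMPLETENESS of a list of Hensel
balls by a residue tree search whose first level enumerates all `p` residues (`List.range p`).  At a
five-digit prime — the split multiplicative place `ℓ = 31891` of the N11 row 287019b1, the 190th and
last row of route planner 1's road D44 — the search itself is sound and even elaborates in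
isolation (`decide +kernel`, ≈ 30 s of kernel time), but inside a record file it ends in
`(kernel) excessive memory consumption detected`: the kernel caches every one of the `ℓ` residue
evaluations.  Route planner 1's DESIGN NOTE D-31891 asked for a CERTIFICATE-FORM decider, "the (ii)
check at `ℓ` reduced to modular arithmetic on supplied witnesses … O(log ℓ) multiplications instead of
the enumerative `checkAt ℓ`".  THIS FILE is the census half of it: completeness is certified by a
supplied FACTORISATION of `F` modulo `p` into linear factors,
`F ≡ lc · ∏ᵢ (X − rᵢ)^{eᵢ} (mod p)` with `p ∤ lc`, together with, for every listed residue `rᵢ`,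
EITHER a certified simple Hensel ball centred in the class of `rᵢ` OR p17's Taylor exclusion test at
level `1` (`RootCensus.dead p l 1 rᵢ`: the class `rᵢ + pℤ_p` holds no root).  A root `z ∈ ℤ_p` of `F`
makes `p` divide `lc · ∏ (z − rᵢ)^{eᵢ}` in `ℤ_p`; `p` is prime there and `p ∤ lc`, so `p ∣ z − rᵢ` for
some `i` — `z` lies in the class of a listed residue, hence in a certified ball (the dead classes
hold no root).  The cost is `deg F` coefficient congruences and `#lin` Taylor expansions: independent
of `p`.

At every multiplicative prime `ℓ ≥ 5` of an elliptic curve, `Ψ₃ mod ℓ = 3 (X − x_t)(X − x₀)³` SPLITS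
(`x₀` the node abscissa, `x_t` the abscissa of the `3`-torsion of the torus), so the split-cover
certificate serves kind (ii) of the refined visibility certificate at ANY such `ℓ`.
-- TODO(general form): a residual factor `G` with no root mod `p` (good / additive places at a large
-- `p` where `Ψ₃ mod p` keeps an irreducible quadratic or cubic factor), certified by
-- `gcd(G, X^p − X) = 1` through `X^p mod G` by repeated squaring.

## What

* `mulLinPow r e l` (coefficient list of `(X − r)^e · G`, by p17's synthetic `mulYr`), `prodLinList lc
  lin` (of `lc · ∏_{(r,e) ∈ lin} (X − r)^e`), `congrList p l l′` (same length, coefficientwise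
  `≡ (mod p)`), `residueOK`, `splitCoverOK`, `check₃` — computable;
* `aeval_ofList_mulLinPow`, `dvd_aeval_sub_of_congrList`,
  `dvd_intCast_or_exists_dvd_sub_of_dvd_aeval_prodLinList` — the algebra;
* **`inBall_of_splitCoverOK`** — every root of `F` in `ℤ_p` lies in a certified ball (the hypothesis
  `hcov` of p17's `RootCensus.exists_roots_of_cover`);
* **`exists_roots_of_check₃`** — the ROOT CENSUS for `check₃` (`entryOK` ∧ `pairwiseOK` ∧
  `splitCoverOK`): p17's `exists_roots_of_cover` BY NAME, same conclusion as `exists_roots_of_check₂`;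
* instances by `decide`: `X² − 7` over `ℤ₃`, and `Ψ₃` of 287019b1 at `ℓ = 31891` (one simple ball at
  `27789`, node class `11998` dead at level `1`);
* `LocalTorsion3At.threeTorsionCertAt p a₁ … a₆ k cert lin : Option ℕ` — n1011-p17's `threeTorsionCheckAt`
  (T-LOC3L FILE L3) with `check₂ ↦ check₃` (leading coefficient `3` of `Ψ₃`); definition only — the decider
  theorem `#E(ℚ_p)[3] = 1 + 2S` is FILE 2.

References: Hensel's lemma (Mathlib `PadicInt`); [SilvermanAEC2009] VII.5 Prop. 5.1 (b) (the node);
cells/n1011/ROUTE-1.md §65.1 (design note D-31891).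
-/

set_option autoImplicit false

open Polynomial

namespace Summit.BirchSwinnertonDyer.Rank1Residual.GaloisImage.RootCensus

/-! ### Coefficient-list arithmetic -/

/-- Coefficient list of `(X − r)^e · G` from that of `G` (`e` synthetic multiplications by
`X + (−r)`, p17's `mulYr`). [folklore] -/
def mulLinPow (r : ℤ) : ℕ → List ℤ → List ℤ
  | 0, l => l
  | e + 1, l => mulYr (-r) (mulLinPow r e l)

/-- Coefficient list of `lc · ∏_{(r, e) ∈ lin} (X − r)^e`. [folklore] -/
def prodLinList (lc : ℤ) : List (ℤ × ℕ) → List ℤ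
  | [] => [lc]
  | re :: lin => mulLinPow re.1 re.2 (prodLinList lc lin)

/-- Two coefficient lists of the same length, congruent coefficientwise modulo `p`. [folklore] -/
def congrList (p : ℕ) : List ℤ → List ℤ → Bool
  | [], [] => true
  | c :: l, c' :: l' => ((c - c') % (p : ℤ) == 0) && congrList p l l'
  | _, _ => false

/-- A listed root residue `r` is ACCOUNTED FOR: a certified Hensel ball with `m = 0` is centred in the
class `r + pℤ_p` (`inBall p cert 1 r`), or the class holds no root by p17's Taylor exclusion test at
level `1` (`dead p l 1 r`). [folklore] -/
def residueOK (p : ℕ) (l : List ℤ) (cert : List (ℤ × ℕ × ℕ)) (r : ℤ) : Bool :=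
  inBall p cert 1 r || dead p l 1 r

/-- **The split-cover certificate**: `p ∤ lc`, `F ≡ lc · ∏ (X − rᵢ)^{eᵢ} (mod p)` coefficientwise, and
every listed residue accounted for. [folklore] -/
def splitCoverOK (p : ℕ) (l : List ℤ) (cert : List (ℤ × ℕ × ℕ)) (lc : ℤ) (lin : List (ℤ × ℕ)) :
    Bool :=
  !(lc % (p : ℤ) == 0) && congrList p l (prodLinList lc lin) && lin.all fun re => residueOK p l cert re.1

/-- **The v3 root-census checker**: entries and disjointness as in p17's `check` / `check₂`, the
residue cover by the split-cover certificate. [folklore] -/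
def check₃ (p : ℕ) (l : List ℤ) (k : ℕ) (cert : List (ℤ × ℕ × ℕ)) (lc : ℤ) (lin : List (ℤ × ℕ)) :
    Bool :=
  cert.all (entryOK p l k) && pairwiseOK p cert && splitCoverOK p l cert lc lin

/-! ### The algebra of the certificate -/

section Aeval

variable {A : Type*} [CommRing A] [Algebra ℤ A] (y : A)

/-- `aeval y (ofList (mulLinPow r e l)) = (y − r)^e · aeval y (ofList l)`. [folklore] -/
theorem aeval_ofList_mulLinPow (r : ℤ) : ∀ (e : ℕ) (l : List ℤ),
    aeval y (ofList (mulLinPow r e l)) = (y - (r : A)) ^ e * aeval y (ofList l)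
  | 0, l => by simp [mulLinPow]
  | e + 1, l => by
    rw [mulLinPow, aeval_ofList_mulYr, aeval_ofList_mulLinPow r e l, pow_succ, Int.cast_neg]
    ring

/-- `aeval y (ofList (prodLinList lc (re :: lin))) = (y − re.1)^{re.2} · aeval y (ofList (prodLinList lc lin))`.
[folklore] -/
theorem aeval_ofList_prodLinList_cons (lc : ℤ) (re : ℤ × ℕ) (lin : List (ℤ × ℕ)) :
    aeval y (ofList (prodLinList lc (re :: lin))) =
      (y - (re.1 : A)) ^ re.2 * aeval y (ofList (prodLinList lc lin)) := by
  rw [prodLinList, aeval_ofList_mulLinPow]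

/-- `aeval y (ofList (prodLinList lc [])) = lc`. [folklore] -/
theorem aeval_ofList_prodLinList_nil (lc : ℤ) : aeval y (ofList (prodLinList lc [])) = (lc : A) := by
  simp [prodLinList]

/-- Coefficientwise congruence gives congruent values at every point of a `ℤ`-algebra:
`p ∣ aeval y (ofList l) − aeval y (ofList l′)`. [folklore] -/
theorem dvd_aeval_sub_of_congrList (p : ℕ) : ∀ (l l' : List ℤ), congrList p l l' = true →
    ((p : ℤ) : A) ∣ aeval y (ofList l) - aeval y (ofList l')
  | [], [], _ => by simp
  | [], _ :: _, h => by simp [congrList] at h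
  | _ :: _, [], h => by simp [congrList] at h
  | c :: l, c' :: l', h => by
    simp only [congrList, Bool.and_eq_true, beq_iff_eq, emod_eq_zero_iff_dvd'] at h
    obtain ⟨hc, hl⟩ := h
    have ih := dvd_aeval_sub_of_congrList p l l' hl
    rw [aeval_ofList_cons, aeval_ofList_cons,
      show (c : A) + y * aeval y (ofList l) - ((c' : A) + y * aeval y (ofList l')) =
        ((c - c' : ℤ) : A) + y * (aeval y (ofList l) - aeval y (ofList l')) by push_cast; ring]
    exact dvd_add (by obtain ⟨d, hd⟩ := hc; exact ⟨(d : A), by rw [hd]; push_cast; ring⟩)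
      (Dvd.dvd.mul_left ih y)

end Aeval

variable {p : ℕ} [hp : Fact p.Prime]

/-- If the prime `p` of `ℤ_p` divides `lc · ∏ (z − rᵢ)^{eᵢ}` then it divides `lc` or some `z − rᵢ`.
[folklore] -/
theorem dvd_intCast_or_exists_dvd_sub_of_dvd_aeval_prodLinList (z : ℤ_[p]) (lc : ℤ) :
    ∀ lin : List (ℤ × ℕ), (p : ℤ_[p]) ∣ aeval z (ofList (prodLinList lc lin)) →
      (p : ℤ_[p]) ∣ (lc : ℤ_[p]) ∨ ∃ re ∈ lin, (p : ℤ_[p]) ∣ z - (re.1 : ℤ_[p])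
  | [], h => by
    left; simpa [prodLinList] using h
  | re :: lin, h => by
    rw [aeval_ofList_prodLinList_cons] at h
    rcases (PadicInt.irreducible_p.prime.dvd_or_dvd h) with h1 | h2
    · exact Or.inr ⟨re, List.mem_cons_self, PadicInt.irreducible_p.prime.dvd_of_dvd_pow h1⟩
    · rcases dvd_intCast_or_exists_dvd_sub_of_dvd_aeval_prodLinList z lc lin h2 with h3 | ⟨re', hre', h4⟩
      · exact Or.inl h3
      · exact Or.inr ⟨re', List.mem_cons_of_mem _ hre', h4⟩

/-- `p ∣ x` in `ℤ_p` gives `‖x‖ ≤ p⁻¹`. [folklore] -/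
theorem norm_le_inv_of_dvd {x : ℤ_[p]} (h : (p : ℤ_[p]) ∣ x) :
    ‖x‖ ≤ (p : ℝ) ^ (-((0 + 1 : ℕ) : ℤ)) := by
  rw [PadicInt.norm_le_pow_iff_norm_lt_pow_add_one]
  have : ‖x‖ < 1 := (PadicInt.norm_lt_one_iff_dvd x).mpr h
  simpa using this

/-- **Soundness of the split-cover certificate**: if `splitCoverOK p l cert lc lin` then every root of
`F = ofList l` in `ℤ_p` lies in a certified ball (`‖z − cᵢ‖ ≤ p^{-(mᵢ+1)}` for some entry
`(cᵢ, mᵢ, Nᵢ)` of `cert`). [folklore] -/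
theorem inBall_of_splitCoverOK {l : List ℤ} {cert : List (ℤ × ℕ × ℕ)} {lc : ℤ} {lin : List (ℤ × ℕ)}
    (h : splitCoverOK p l cert lc lin = true) (z : ℤ_[p]) (hz : aeval z (ofList l) = 0) :
    ∃ e ∈ cert, ‖z - (e.1 : ℤ_[p])‖ ≤ (p : ℝ) ^ (-((e.2.1 + 1 : ℕ) : ℤ)) := by
  simp only [splitCoverOK, Bool.and_eq_true, Bool.not_eq_true', beq_eq_false_iff_ne, ne_eq,
    emod_eq_zero_iff_dvd', List.all_eq_true] at h
  obtain ⟨⟨hlc, hcongr⟩, hres⟩ := h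
  -- `p ∣ lc · ∏ (z − rᵢ)^{eᵢ}` in `ℤ_p`
  have hdvd : (p : ℤ_[p]) ∣ aeval z (ofList (prodLinList lc lin)) := by
    have h1 := dvd_aeval_sub_of_congrList z p l (prodLinList lc lin) hcongr
    rw [hz, zero_sub, dvd_neg] at h1
    exact_mod_cast h1
  rcases dvd_intCast_or_exists_dvd_sub_of_dvd_aeval_prodLinList z lc lin hdvd with h1 | ⟨re, hre, h2⟩
  · -- `p ∣ lc`: excluded by the certificate
    exact absurd ((PadicInt.norm_int_lt_one_iff_dvd lc).mp ((PadicInt.norm_lt_one_iff_dvd _).mpr h1)) hlc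
  · -- `z` is in the class of the listed residue `re.1`
    have hzr : ‖z - (re.1 : ℤ_[p])‖ ≤ (p : ℝ) ^ (-((0 + 1 : ℕ) : ℤ)) := norm_le_inv_of_dvd h2
    have hok := hres re hre
    simp only [residueOK, Bool.or_eq_true] at hok
    rcases hok with hball | hdead
    · -- a certified ball with `m = 0` is centred in this class
      simp only [inBall, List.any_eq_true, Bool.and_eq_true, decide_eq_true_eq, beq_iff_eq,
        emod_eq_zero_iff_dvd'] at hball
      obtain ⟨e, he, hm, hre1⟩ := hball
      have hm0 : e.2.1 = 0 := by omega
      refine ⟨e, he, ?_⟩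
      have hrc : ‖((re.1 : ℤ_[p]) - (e.1 : ℤ_[p]))‖ ≤ (p : ℝ) ^ (-((e.2.1 + 1 : ℕ) : ℤ)) := by
        rw [← Int.cast_sub]; exact norm_intCast_le_of_dvd hre1
      calc ‖z - (e.1 : ℤ_[p])‖ = ‖(z - (re.1 : ℤ_[p])) + ((re.1 : ℤ_[p]) - (e.1 : ℤ_[p]))‖ := by ring_nf
        _ ≤ max ‖z - (re.1 : ℤ_[p])‖ ‖(re.1 : ℤ_[p]) - (e.1 : ℤ_[p])‖ := PadicInt.nonarchimedean _ _
        _ ≤ (p : ℝ) ^ (-((e.2.1 + 1 : ℕ) : ℤ)) := max_le (by rw [hm0]; exact hzr) hrc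
    · -- the class holds no root: contradiction
      exact absurd hz (aeval_ne_zero_of_dead hdead (by simpa using hzr))

/-- **ROOT CENSUS** for the checker `RootCensus.check₃` (split-cover certificate): the roots of
`F = ofList l` in `ℤ_p` are exactly `cert.length` pairwise distinct Hensel roots, the `i`-th within
`p^{-(Nᵢ − mᵢ)}` of `cᵢ` — p17's `exists_roots_of_cover` with the cover supplied by
`inBall_of_splitCoverOK`; same conclusion as `exists_roots_of_check₂`. [folklore] -/
theorem exists_roots_of_check₃ (l : List ℤ) (k : ℕ) (cert : List (ℤ × ℕ × ℕ)) (lc : ℤ)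
    (lin : List (ℤ × ℕ)) (h : check₃ p l k cert lc lin = true) :
    ∃ ρ : Fin cert.length → ℤ_[p], Function.Injective ρ ∧
      (∀ i, aeval (ρ i) (ofList l) = 0 ∧
        ‖ρ i - ((cert.get i).1 : ℤ_[p])‖ < (p : ℝ) ^ (-((cert.get i).2.1 : ℤ)) ∧
        ‖ρ i - ((cert.get i).1 : ℤ_[p])‖ ≤
          (p : ℝ) ^ (-(((cert.get i).2.2 - (cert.get i).2.1 : ℕ) : ℤ))) ∧
      ∀ z : ℤ_[p], aeval z (ofList l) = 0 → ∃ i, ρ i = z := by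
  simp only [check₃, Bool.and_eq_true, List.all_eq_true] at h
  obtain ⟨⟨hent, hpw⟩, hcov⟩ := h
  exact exists_roots_of_cover l k cert hent hpw (inBall_of_splitCoverOK hcov)

/-! ### Instances -/

/-- Sanity check: `X² − 7` over `ℤ₃` — `X² − 7 ≡ (X − 1)(X − 2) (mod 3)`, both classes carry a
simple Hensel ball. [folklore] -/
example : check₃ 3 [-7, 0, 1] 1 [((1 : ℤ), 0, 1), (-1, 0, 1)] 1 [((1 : ℤ), 1), (2, 1)] = true := by
  decide

/-- The `Ψ₃ = [b₈, 3b₆, 3b₄, b₂, 3]` of the N11 row 287019b1 (`[1, -1, 1, -17930, -919592]`) at its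
split multiplicative prime `ℓ = 31891`: `Ψ₃ ≡ 3 (X − 27789)(X − 11998)³ (mod ℓ)`; the torus class
`27789` carries the simple ball `(27789, 0, 1)`, the node class `11998` is Taylor-dead at level `1`
(`v_ℓ Ψ₃(11998) = 1 < v_ℓ(cᵢ) + i`). Five coefficient congruences and two Taylor expansions — where
`check₂` expands `31891` residues. [folklore] -/
example : check₃ 31891 [-318708195, -11035101, -107577, -3, 3] 1 [((27789 : ℤ), 0, 1)] 3
    [((27789 : ℤ), 1), (11998, 3)] = true := by
  decide

end Summit.BirchSwinnertonDyer.Rank1Residual.GaloisImage.RootCensus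

/-! ### The certificate-form local `3`-torsion checker (definition; its theorems are FILE 2) -/

namespace Summit.BirchSwinnertonDyer.Rank1Residual.GaloisImage.LocalTorsion3At

open LocalTorsion3 (psi3List gList toRootEntry)

/-- **The certificate-form checker at `p`.** `some S` iff the split-cover root census
(`RootCensus.check₃ p … 3 lin`: leading coefficient `3` of `Ψ₃`, linear factors `lin`) of `Ψ₃` succeeds
at precision `k` on the balls of `cert` and every entry's `g`-data checks (`gEntryOKAt`); `S` = number of
entries with a square `g` (`sqFlagAt`) — n1011-p17's `threeTorsionCheckAt` with `check₂ ↦ check₃`.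
[folklore] -/
def threeTorsionCertAt (p : ℕ) (a₁ a₂ a₃ a₄ a₆ : ℤ) (k : ℕ) (cert : List (ℤ × ℕ × ℕ × ℕ))
    (lin : List (ℤ × ℕ)) : Option ℕ :=
  if RootCensus.check₃ p (psi3List a₁ a₂ a₃ a₄ a₆) k (cert.map toRootEntry) 3 lin &&
      cert.all (gEntryOKAt p (gList a₁ a₂ a₃ a₄ a₆))
  then some (cert.countP fun e => sqFlagAt p (RootCensus.evalList (gList a₁ a₂ a₃ a₄ a₆) e.1) e.2.2.2)
  else none

end Summit.BirchSwinnertonDyer.Rank1Residual.GaloisImage.LocalTorsion3At
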